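import Mathlib
import HarnessLib
import Summits.QuantumFields.YangMills.Theorems.MirrorModularBoostsHypercubicLimitIRInputsDefs
import Literature.MathematicalPhysics.QuantumFieldTheory.LatticeGaugeProofs
import Literature.MathematicalPhysics.QuantumFieldTheory.SpeciesLatticeProducts

/-!
# Stub `stub_irInputsRecentre` for the crux `WeakCouplingHypercubicLimit` (line `Sketch`, W2)

`IRInputs r sch` is blind to the additive counterterms `sch.m`: re-centring the scheme,
`sch ↦ sch' = ⟨sch.a, sch.a_pos, sch.tendsto_a, sch.β, sch.L, sch.tendsto_L, sch.c, m'⟩` (the scheme `sch`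
with its counterterm replaced by `m'`; this is the very term the structure-update notation elaborates
to — same spacings, couplings, volumes, multiplicative renormalisations), preserves it.

* Clauses (a) `HasLatticeMassGap` and (b) (RP-spectral clustering of slab functionals) read only
  `β, a, L`, which agree definitionally.
* In (c), (d) every smeared curvature field of `sch'` is that of `sch` plus the
  constant `c_k a_k⁴ (Σ_{x ∈ box} f(a_k x)) (m_k − m'_k)` (`irRecentre_smearedLatticeField_shift`),
  and the second and third cumulants of bounded random variables under a probability measure
  (Wilson's torus measure, `isProbabilityMeasure_wilsonMeasure`) are invariant under constant
  shifts (`irRecentre_cumulant_two`, `irRecentre_cumulant_three`); so the floors hold for the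
  re-centred scheme with the same test functions and the same `δ` (`irRecentre_two`,
  `irRecentre_three`: the truncated lattice functions agree for every `k`).
-/

noncomputable section

open scoped SchwartzMap
open MeasureTheory Filter Topology
open Literature.MathematicalPhysics.AQFT Literature.MathematicalPhysics.QuantumLattice
open Literature.MathematicalPhysics.QuantumFieldTheory
open Literature.Probability.LatticeModels (box)
open Summit.QuantumFields.YangMills.Cruxes.HypercubicLimit.CouplingResponse

namespace Summit.QuantumFields.YangMills.Theorems.WeakCouplingHypercubicLimit.TraceNormColdPressure

/-! ### Cumulants of bounded random variables are shift invariant -/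

section Cumulants

variable {α : Type*}

/-- The product of two bounded real functions is bounded. [folklore] -/
theorem irRecentre_bdd_mul {X Y : α → ℝ} (hX : ∃ B, ∀ ω, |X ω| ≤ B) (hY : ∃ B, ∀ ω, |Y ω| ≤ B) :
    ∃ B, ∀ ω, |X ω * Y ω| ≤ B := by
  obtain ⟨B, hB⟩ := hX
  obtain ⟨C, hC⟩ := hY
  refine ⟨B * C, fun ω => ?_⟩
  rw [abs_mul]
  exact mul_le_mul (hB ω) (hC ω) (abs_nonneg _) ((abs_nonneg _).trans (hB ω))

variable [MeasurableSpace α] {μ : Measure α}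

/-- A bounded measurable real function is integrable for a finite measure. [folklore] -/
theorem irRecentre_integrable [IsFiniteMeasure μ] {X : α → ℝ} (hm : Measurable X)
    (hb : ∃ B, ∀ ω, |X ω| ≤ B) : Integrable X μ := by
  obtain ⟨B, hB⟩ := hb
  exact Integrable.of_bound hm.aestronglyMeasurable B
    (ae_of_all _ fun ω => (Real.norm_eq_abs _).le.trans (hB ω))

/-- First moment of a shifted variable: `E[X + p] = E[X] + p` (probability measure). [folklore] -/
theorem irRecentre_moment_one [IsProbabilityMeasure μ] {X : α → ℝ} (hX : Integrable X μ) (p : ℝ) :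
    ∫ ω, (X ω + p) ∂μ = (∫ ω, X ω ∂μ) + p := by
  rw [integral_add hX (integrable_const _), integral_const, probReal_univ, one_smul]

/-- Mixed second moment of shifted variables:
`E[(X + p)(Y + q)] = E[XY] + q E[X] + p E[Y] + pq` (probability measure). [folklore] -/
theorem irRecentre_moment_two [IsProbabilityMeasure μ] {X Y : α → ℝ} (hX : Integrable X μ)
    (hY : Integrable Y μ) (hXY : Integrable (fun ω => X ω * Y ω) μ) (p q : ℝ) :
    ∫ ω, (X ω + p) * (Y ω + q) ∂μ =
      (∫ ω, X ω * Y ω ∂μ) + q * (∫ ω, X ω ∂μ) + p * (∫ ω, Y ω ∂μ) + p * q := by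
  have i1 : Integrable (fun ω => q * X ω) μ := hX.const_mul q
  have i2 : Integrable (fun ω => p * Y ω) μ := hY.const_mul p
  have j1 : Integrable (fun ω => X ω * Y ω + q * X ω) μ := hXY.add i1
  have j2 : Integrable (fun ω => X ω * Y ω + q * X ω + p * Y ω) μ := j1.add i2
  have e : (fun ω => (X ω + p) * (Y ω + q)) =
      fun ω => X ω * Y ω + q * X ω + p * Y ω + p * q := by
    funext ω; ring
  rw [e, integral_add j2 (integrable_const _), integral_add j1 i2, integral_add hXY i1]
  simp only [integral_const_mul, integral_const, probReal_univ, one_smul]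

/-- Mixed third moment of shifted variables, fully expanded (probability measure). [folklore] -/
theorem irRecentre_moment_three [IsProbabilityMeasure μ] {X Y Z : α → ℝ} (hX : Integrable X μ)
    (hY : Integrable Y μ) (hZ : Integrable Z μ) (hXY : Integrable (fun ω => X ω * Y ω) μ)
    (hXZ : Integrable (fun ω => X ω * Z ω) μ) (hYZ : Integrable (fun ω => Y ω * Z ω) μ)
    (hXYZ : Integrable (fun ω => X ω * Y ω * Z ω) μ) (p q s : ℝ) :
    ∫ ω, (X ω + p) * (Y ω + q) * (Z ω + s) ∂μ =
      (∫ ω, X ω * Y ω * Z ω ∂μ) + s * (∫ ω, X ω * Y ω ∂μ) + q * (∫ ω, X ω * Z ω ∂μ) +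
        p * (∫ ω, Y ω * Z ω ∂μ) + q * s * (∫ ω, X ω ∂μ) + p * s * (∫ ω, Y ω ∂μ) +
        p * q * (∫ ω, Z ω ∂μ) + p * q * s := by
  have i1 : Integrable (fun ω => s * (X ω * Y ω)) μ := hXY.const_mul s
  have i2 : Integrable (fun ω => q * (X ω * Z ω)) μ := hXZ.const_mul q
  have i3 : Integrable (fun ω => p * (Y ω * Z ω)) μ := hYZ.const_mul p
  have i4 : Integrable (fun ω => q * s * X ω) μ := hX.const_mul (q * s)
  have i5 : Integrable (fun ω => p * s * Y ω) μ := hY.const_mul (p * s)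
  have i6 : Integrable (fun ω => p * q * Z ω) μ := hZ.const_mul (p * q)
  have j1 : Integrable (fun ω => X ω * Y ω * Z ω + s * (X ω * Y ω)) μ := hXYZ.add i1
  have j2 : Integrable (fun ω => X ω * Y ω * Z ω + s * (X ω * Y ω) + q * (X ω * Z ω)) μ :=
    j1.add i2
  have j3 : Integrable (fun ω => X ω * Y ω * Z ω + s * (X ω * Y ω) + q * (X ω * Z ω) +
      p * (Y ω * Z ω)) μ := j2.add i3
  have j4 : Integrable (fun ω => X ω * Y ω * Z ω + s * (X ω * Y ω) + q * (X ω * Z ω) +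
      p * (Y ω * Z ω) + q * s * X ω) μ := j3.add i4
  have j5 : Integrable (fun ω => X ω * Y ω * Z ω + s * (X ω * Y ω) + q * (X ω * Z ω) +
      p * (Y ω * Z ω) + q * s * X ω + p * s * Y ω) μ := j4.add i5
  have j6 : Integrable (fun ω => X ω * Y ω * Z ω + s * (X ω * Y ω) + q * (X ω * Z ω) +
      p * (Y ω * Z ω) + q * s * X ω + p * s * Y ω + p * q * Z ω) μ := j5.add i6
  have e : (fun ω => (X ω + p) * (Y ω + q) * (Z ω + s)) =
      fun ω => X ω * Y ω * Z ω + s * (X ω * Y ω) + q * (X ω * Z ω) + p * (Y ω * Z ω) +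
        q * s * X ω + p * s * Y ω + p * q * Z ω + p * q * s := by
    funext ω; ring
  rw [e, integral_add j6 (integrable_const _), integral_add j5 i6, integral_add j4 i5,
    integral_add j3 i4, integral_add j2 i3, integral_add j1 i2, integral_add hXYZ i1]
  simp only [integral_const_mul, integral_const, probReal_univ, one_smul]

/-- **The second cumulant is shift invariant**: for bounded measurable `X, Y` under a probability
measure and constants `p, q`, `E[(X+p)(Y+q)] − E[X+p] E[Y+q] = E[XY] − E[X] E[Y]`. [folklore] -/
theorem irRecentre_cumulant_two [IsProbabilityMeasure μ] {X Y : α → ℝ} (hXm : Measurable X)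
    (hXb : ∃ B, ∀ ω, |X ω| ≤ B) (hYm : Measurable Y) (hYb : ∃ B, ∀ ω, |Y ω| ≤ B) (p q : ℝ) :
    (∫ ω, (X ω + p) * (Y ω + q) ∂μ) - (∫ ω, (X ω + p) ∂μ) * (∫ ω, (Y ω + q) ∂μ) =
      (∫ ω, X ω * Y ω ∂μ) - (∫ ω, X ω ∂μ) * (∫ ω, Y ω ∂μ) := by
  have hX : Integrable X μ := irRecentre_integrable hXm hXb
  have hY : Integrable Y μ := irRecentre_integrable hYm hYb
  have hXY : Integrable (fun ω => X ω * Y ω) μ :=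
    irRecentre_integrable (hXm.mul hYm) (irRecentre_bdd_mul hXb hYb)
  rw [irRecentre_moment_two hX hY hXY, irRecentre_moment_one hX, irRecentre_moment_one hY]
  ring

/-- **The third cumulant is shift invariant**: for bounded measurable `X, Y, Z` under a
probability measure and constants `p, q, s`, the combination
`E[XYZ] − E[X]E[YZ] − E[Y]E[XZ] − E[Z]E[XY] + 2E[X]E[Y]E[Z]` is unchanged under
`X, Y, Z ↦ X + p, Y + q, Z + s`. [folklore] -/
theorem irRecentre_cumulant_three [IsProbabilityMeasure μ] {X Y Z : α → ℝ} (hXm : Measurable X)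
    (hXb : ∃ B, ∀ ω, |X ω| ≤ B) (hYm : Measurable Y) (hYb : ∃ B, ∀ ω, |Y ω| ≤ B)
    (hZm : Measurable Z) (hZb : ∃ B, ∀ ω, |Z ω| ≤ B) (p q s : ℝ) :
    (∫ ω, (X ω + p) * (Y ω + q) * (Z ω + s) ∂μ) -
          (∫ ω, (X ω + p) ∂μ) * (∫ ω, (Y ω + q) * (Z ω + s) ∂μ) -
          (∫ ω, (Y ω + q) ∂μ) * (∫ ω, (X ω + p) * (Z ω + s) ∂μ) -
          (∫ ω, (Z ω + s) ∂μ) * (∫ ω, (X ω + p) * (Y ω + q) ∂μ) +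
        2 * ((∫ ω, (X ω + p) ∂μ) * (∫ ω, (Y ω + q) ∂μ) * (∫ ω, (Z ω + s) ∂μ)) =
      (∫ ω, X ω * Y ω * Z ω ∂μ) -
          (∫ ω, X ω ∂μ) * (∫ ω, Y ω * Z ω ∂μ) -
          (∫ ω, Y ω ∂μ) * (∫ ω, X ω * Z ω ∂μ) -
          (∫ ω, Z ω ∂μ) * (∫ ω, X ω * Y ω ∂μ) +
        2 * ((∫ ω, X ω ∂μ) * (∫ ω, Y ω ∂μ) * (∫ ω, Z ω ∂μ)) := by
  have hX : Integrable X μ := irRecentre_integrable hXm hXb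
  have hY : Integrable Y μ := irRecentre_integrable hYm hYb
  have hZ : Integrable Z μ := irRecentre_integrable hZm hZb
  have hXY : Integrable (fun ω => X ω * Y ω) μ :=
    irRecentre_integrable (hXm.mul hYm) (irRecentre_bdd_mul hXb hYb)
  have hXZ : Integrable (fun ω => X ω * Z ω) μ :=
    irRecentre_integrable (hXm.mul hZm) (irRecentre_bdd_mul hXb hZb)
  have hYZ : Integrable (fun ω => Y ω * Z ω) μ :=
    irRecentre_integrable (hYm.mul hZm) (irRecentre_bdd_mul hYb hZb)
  have hXYZ : Integrable (fun ω => X ω * Y ω * Z ω) μ :=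
    irRecentre_integrable ((hXm.mul hYm).mul hZm) (irRecentre_bdd_mul (irRecentre_bdd_mul hXb hYb) hZb)
  rw [irRecentre_moment_three hX hY hZ hXY hXZ hYZ hXYZ, irRecentre_moment_two hY hZ hYZ,
    irRecentre_moment_two hX hZ hXZ, irRecentre_moment_two hX hY hXY, irRecentre_moment_one hX,
    irRecentre_moment_one hY, irRecentre_moment_one hZ]
  ring

end Cumulants

/-! ### Re-centring a smeared lattice field shifts it by a constant -/

section Shift

variable {G : Type} [Group G] [MeasurableSpace G]

omit [Group G] in
/-- **Re-centring identity**: changing the additive counterterm `m ↦ m'` shifts the smeared field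
by the constant `c a⁴ (Σ_{x ∈ Λ} f(a x)) (m − m')`. [folklore] -/
theorem irRecentre_smearedLatticeField_shift (O : LGConfig 4 G → ℝ)
    (Λ : Finset (Literature.Probability.LatticeModels.Site 4)) (a c m m' : ℝ)
    (f : 𝓢(EuclideanSpace ℝ (Fin 4), ℝ)) (U : LGConfig 4 G) :
    smearedLatticeField O Λ a c m' f U =
      smearedLatticeField O Λ a c m f U + c * a ^ 4 * (∑ x ∈ Λ, f (a • siteToE x)) * (m - m') := by
  unfold smearedLatticeField
  rw [Finset.mul_sum, Finset.mul_sum, Finset.mul_sum, Finset.sum_mul, ← Finset.sum_add_distrib]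
  exact Finset.sum_congr rfl fun x _ => by ring

/-- The smeared field of a species read on the scheme's torus is measurable and bounded.
[folklore] -/
theorem irRecentre_field (sch : SpeciesScheme (YMSpecies G)) (k : ℕ) (s : YMSpecies G) (m : ℝ)
    (f : 𝓢(EuclideanSpace ℝ (Fin 4), ℝ)) :
    (Measurable fun U : GaugeConfig 4 (sch.side k) G =>
        smearedLatticeField s.F (box 4 (sch.L k)) (sch.a k) (sch.c s k) m f
          (torusLift (sch.side k) U)) ∧
      ∃ B, ∀ U : GaugeConfig 4 (sch.side k) G,
        |smearedLatticeField s.F (box 4 (sch.L k)) (sch.a k) (sch.c s k) m f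
          (torusLift (sch.side k) U)| ≤ B := by
  obtain ⟨B, hB⟩ := exists_bound_smearedLatticeField s.bounded (box 4 (sch.L k)) (sch.a k)
    (sch.c s k) m f
  exact ⟨measurable_smearedLatticeField_torusLift s _ _ _ _ f _, B, fun U => hB _⟩

end Shift

/-! ### The truncated lattice functions of `sch` and `⟨sch.a, sch.a_pos, sch.tendsto_a, sch.β, sch.L, sch.tendsto_L, sch.c, m'⟩` agree -/

section App

variable {G : Type} [Group G] [TopologicalSpace G] [IsTopologicalGroup G] [CompactSpace G]
  [MeasurableSpace G] [BorelSpace G]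

/-- The lattice `n`-point function of the re-centred scheme, unfolded on the torus of `sch`
(all data but the counterterm agree definitionally). [folklore] -/
theorem irRecentre_latticeSchwinger_with {N : ℕ} {ι : Type} (ρ : G →* Matrix (Fin N) (Fin N) ℂ)
    (sch : SpeciesScheme ι) (m' : ι → ℕ → ℝ) (obs : ι → LGConfig 4 G → ℝ) (k n : ℕ)
    (σ : Fin n → ι) (f : Fin n → 𝓢(EuclideanSpace ℝ (Fin 4), ℝ)) :
    latticeSchwinger ρ ⟨sch.a, sch.a_pos, sch.tendsto_a, sch.β, sch.L, sch.tendsto_L, sch.c, m'⟩ obs k n σ f =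
      ∫ U, ∏ i, smearedLatticeField (obs (σ i)) (box 4 (sch.L k)) (sch.a k) (sch.c (σ i) k)
          (m' (σ i) k) (f i) (torusLift (sch.side k) U)
        ∂(wilsonMeasure (d := 4) (L := sch.side k) ρ (sch.β k)) :=
  rfl

/-- One-point function of `sch` as a torus integral. [folklore] -/
theorem irRecentre_S1 (r : LatticeRep G) (sch : SpeciesScheme (YMSpecies G)) (k : ℕ)
    (s : YMSpecies G) (f : 𝓢(EuclideanSpace ℝ (Fin 4), ℝ)) :
    latticeSchwinger r.ρ sch (fun s => s.F) k 1 (fun _ => s) ![f] =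
      ∫ U, smearedLatticeField s.F (box 4 (sch.L k)) (sch.a k) (sch.c s k) (sch.m s k) f
        (torusLift (sch.side k) U) ∂(wilsonMeasure (d := 4) (L := sch.side k) r.ρ (sch.β k)) := by
  unfold latticeSchwinger
  simp only [Fin.prod_univ_one, Matrix.cons_val_fin_one]

/-- Two-point function of `sch` as a torus integral. [folklore] -/
theorem irRecentre_S2 (r : LatticeRep G) (sch : SpeciesScheme (YMSpecies G)) (k : ℕ)
    (s : YMSpecies G) (f g : 𝓢(EuclideanSpace ℝ (Fin 4), ℝ)) :
    latticeSchwinger r.ρ sch (fun s => s.F) k 2 (fun _ => s) ![f, g] =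
      ∫ U, smearedLatticeField s.F (box 4 (sch.L k)) (sch.a k) (sch.c s k) (sch.m s k) f
          (torusLift (sch.side k) U) *
        smearedLatticeField s.F (box 4 (sch.L k)) (sch.a k) (sch.c s k) (sch.m s k) g
          (torusLift (sch.side k) U) ∂(wilsonMeasure (d := 4) (L := sch.side k) r.ρ (sch.β k)) := by
  unfold latticeSchwinger
  simp only [Fin.prod_univ_two, Matrix.cons_val_zero, Matrix.cons_val_one]

/-- Three-point function of `sch` as a torus integral. [folklore] -/
theorem irRecentre_S3 (r : LatticeRep G) (sch : SpeciesScheme (YMSpecies G)) (k : ℕ)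
    (s : YMSpecies G) (f g h : 𝓢(EuclideanSpace ℝ (Fin 4), ℝ)) :
    latticeSchwinger r.ρ sch (fun s => s.F) k 3 (fun _ => s) ![f, g, h] =
      ∫ U, smearedLatticeField s.F (box 4 (sch.L k)) (sch.a k) (sch.c s k) (sch.m s k) f
          (torusLift (sch.side k) U) *
        smearedLatticeField s.F (box 4 (sch.L k)) (sch.a k) (sch.c s k) (sch.m s k) g
          (torusLift (sch.side k) U) *
        smearedLatticeField s.F (box 4 (sch.L k)) (sch.a k) (sch.c s k) (sch.m s k) h
          (torusLift (sch.side k) U) ∂(wilsonMeasure (d := 4) (L := sch.side k) r.ρ (sch.β k)) := by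
  unfold latticeSchwinger
  simp only [Fin.prod_univ_three, Matrix.cons_val_zero, Matrix.cons_val_one, Matrix.head_cons,
    Matrix.cons_val_two, Matrix.tail_cons]

/-- One-point function of the re-centred scheme: the field of `sch` plus a constant. [folklore] -/
theorem irRecentre_S1' (r : LatticeRep G) (sch : SpeciesScheme (YMSpecies G))
    (m' : YMSpecies G → ℕ → ℝ) (k : ℕ) (s : YMSpecies G) (f : 𝓢(EuclideanSpace ℝ (Fin 4), ℝ)) :
    latticeSchwinger r.ρ ⟨sch.a, sch.a_pos, sch.tendsto_a, sch.β, sch.L, sch.tendsto_L, sch.c, m'⟩ (fun s => s.F) k 1 (fun _ => s) ![f] =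
      ∫ U, (smearedLatticeField s.F (box 4 (sch.L k)) (sch.a k) (sch.c s k) (sch.m s k) f
          (torusLift (sch.side k) U) +
        sch.c s k * sch.a k ^ 4 * (∑ x ∈ box 4 (sch.L k), f (sch.a k • siteToE x)) *
          (sch.m s k - m' s k)) ∂(wilsonMeasure (d := 4) (L := sch.side k) r.ρ (sch.β k)) := by
  rw [irRecentre_latticeSchwinger_with]
  simp only [Fin.prod_univ_one, Matrix.cons_val_fin_one,
    irRecentre_smearedLatticeField_shift _ _ _ _ (sch.m s k) (m' s k)]

/-- Two-point function of the re-centred scheme: fields of `sch` plus constants. [folklore] -/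
theorem irRecentre_S2' (r : LatticeRep G) (sch : SpeciesScheme (YMSpecies G))
    (m' : YMSpecies G → ℕ → ℝ) (k : ℕ) (s : YMSpecies G)
    (f g : 𝓢(EuclideanSpace ℝ (Fin 4), ℝ)) :
    latticeSchwinger r.ρ ⟨sch.a, sch.a_pos, sch.tendsto_a, sch.β, sch.L, sch.tendsto_L, sch.c, m'⟩ (fun s => s.F) k 2 (fun _ => s) ![f, g] =
      ∫ U, (smearedLatticeField s.F (box 4 (sch.L k)) (sch.a k) (sch.c s k) (sch.m s k) f
            (torusLift (sch.side k) U) +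
          sch.c s k * sch.a k ^ 4 * (∑ x ∈ box 4 (sch.L k), f (sch.a k • siteToE x)) *
            (sch.m s k - m' s k)) *
        (smearedLatticeField s.F (box 4 (sch.L k)) (sch.a k) (sch.c s k) (sch.m s k) g
            (torusLift (sch.side k) U) +
          sch.c s k * sch.a k ^ 4 * (∑ x ∈ box 4 (sch.L k), g (sch.a k • siteToE x)) *
            (sch.m s k - m' s k)) ∂(wilsonMeasure (d := 4) (L := sch.side k) r.ρ (sch.β k)) := by
  rw [irRecentre_latticeSchwinger_with]
  simp only [Fin.prod_univ_two, Matrix.cons_val_zero, Matrix.cons_val_one,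
    irRecentre_smearedLatticeField_shift _ _ _ _ (sch.m s k) (m' s k)]

/-- Three-point function of the re-centred scheme: fields of `sch` plus constants. [folklore] -/
theorem irRecentre_S3' (r : LatticeRep G) (sch : SpeciesScheme (YMSpecies G))
    (m' : YMSpecies G → ℕ → ℝ) (k : ℕ) (s : YMSpecies G)
    (f g h : 𝓢(EuclideanSpace ℝ (Fin 4), ℝ)) :
    latticeSchwinger r.ρ ⟨sch.a, sch.a_pos, sch.tendsto_a, sch.β, sch.L, sch.tendsto_L, sch.c, m'⟩ (fun s => s.F) k 3 (fun _ => s) ![f, g, h] =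
      ∫ U, (smearedLatticeField s.F (box 4 (sch.L k)) (sch.a k) (sch.c s k) (sch.m s k) f
            (torusLift (sch.side k) U) +
          sch.c s k * sch.a k ^ 4 * (∑ x ∈ box 4 (sch.L k), f (sch.a k • siteToE x)) *
            (sch.m s k - m' s k)) *
        (smearedLatticeField s.F (box 4 (sch.L k)) (sch.a k) (sch.c s k) (sch.m s k) g
            (torusLift (sch.side k) U) +
          sch.c s k * sch.a k ^ 4 * (∑ x ∈ box 4 (sch.L k), g (sch.a k • siteToE x)) *
            (sch.m s k - m' s k)) *
        (smearedLatticeField s.F (box 4 (sch.L k)) (sch.a k) (sch.c s k) (sch.m s k) h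
            (torusLift (sch.side k) U) +
          sch.c s k * sch.a k ^ 4 * (∑ x ∈ box 4 (sch.L k), h (sch.a k • siteToE x)) *
            (sch.m s k - m' s k)) ∂(wilsonMeasure (d := 4) (L := sch.side k) r.ρ (sch.β k)) := by
  rw [irRecentre_latticeSchwinger_with]
  simp only [Fin.prod_univ_three, Matrix.cons_val_zero, Matrix.cons_val_one, Matrix.head_cons,
    Matrix.cons_val_two, Matrix.tail_cons,
    irRecentre_smearedLatticeField_shift _ _ _ _ (sch.m s k) (m' s k)]

/-- **The truncated lattice two-point function of the curvature is unchanged by re-centring**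
(clause (c) of `IRInputs`, for every `k`). [folklore] -/
theorem irRecentre_two (r : LatticeRep G) (sch : SpeciesScheme (YMSpecies G))
    (m' : YMSpecies G → ℕ → ℝ) (k : ℕ) (u v : 𝓢(EuclideanSpace ℝ (Fin 4), ℝ)) :
    latticeSchwinger r.ρ ⟨sch.a, sch.a_pos, sch.tendsto_a, sch.β, sch.L, sch.tendsto_L, sch.c, m'⟩ (fun s => s.F) k (1 + 1) (fun _ => r.curvature)
          ![u, v] -
        latticeSchwinger r.ρ ⟨sch.a, sch.a_pos, sch.tendsto_a, sch.β, sch.L, sch.tendsto_L, sch.c, m'⟩ (fun s => s.F) k 1 (fun _ => r.curvature) ![u] *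
          latticeSchwinger r.ρ ⟨sch.a, sch.a_pos, sch.tendsto_a, sch.β, sch.L, sch.tendsto_L, sch.c, m'⟩ (fun s => s.F) k 1 (fun _ => r.curvature)
            ![v] =
      latticeSchwinger r.ρ sch (fun s => s.F) k (1 + 1) (fun _ => r.curvature) ![u, v] -
        latticeSchwinger r.ρ sch (fun s => s.F) k 1 (fun _ => r.curvature) ![u] *
          latticeSchwinger r.ρ sch (fun s => s.F) k 1 (fun _ => r.curvature) ![v] := by
  haveI := isProbabilityMeasure_wilsonMeasure (d := 4) (L := sch.side k) r.ρ r.continuous (sch.β k)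
  obtain ⟨hum, hub⟩ := irRecentre_field sch k r.curvature (sch.m r.curvature k) u
  obtain ⟨hvm, hvb⟩ := irRecentre_field sch k r.curvature (sch.m r.curvature k) v
  show latticeSchwinger r.ρ ⟨sch.a, sch.a_pos, sch.tendsto_a, sch.β, sch.L, sch.tendsto_L, sch.c, m'⟩ (fun s => s.F) k 2 (fun _ => r.curvature) ![u, v] -
        latticeSchwinger r.ρ ⟨sch.a, sch.a_pos, sch.tendsto_a, sch.β, sch.L, sch.tendsto_L, sch.c, m'⟩ (fun s => s.F) k 1 (fun _ => r.curvature) ![u] *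
          latticeSchwinger r.ρ ⟨sch.a, sch.a_pos, sch.tendsto_a, sch.β, sch.L, sch.tendsto_L, sch.c, m'⟩ (fun s => s.F) k 1 (fun _ => r.curvature)
            ![v] =
      latticeSchwinger r.ρ sch (fun s => s.F) k 2 (fun _ => r.curvature) ![u, v] -
        latticeSchwinger r.ρ sch (fun s => s.F) k 1 (fun _ => r.curvature) ![u] *
          latticeSchwinger r.ρ sch (fun s => s.F) k 1 (fun _ => r.curvature) ![v]
  rw [irRecentre_S2' r sch m' k, irRecentre_S1' r sch m' k, irRecentre_S1' r sch m' k,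
    irRecentre_S2 r sch k, irRecentre_S1 r sch k, irRecentre_S1 r sch k]
  exact irRecentre_cumulant_two hum hub hvm hvb _ _

/-- **The lattice third cumulant of the curvature is unchanged by re-centring** (clause (d) of
`IRInputs`, for every `k`). [folklore] -/
theorem irRecentre_three (r : LatticeRep G) (sch : SpeciesScheme (YMSpecies G))
    (m' : YMSpecies G → ℕ → ℝ) (k : ℕ) (f g h : 𝓢(EuclideanSpace ℝ (Fin 4), ℝ)) :
    latticeSchwinger r.ρ ⟨sch.a, sch.a_pos, sch.tendsto_a, sch.β, sch.L, sch.tendsto_L, sch.c, m'⟩ (fun s => s.F) k 3 (fun _ => r.curvature)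
          ![f, g, h] -
        latticeSchwinger r.ρ ⟨sch.a, sch.a_pos, sch.tendsto_a, sch.β, sch.L, sch.tendsto_L, sch.c, m'⟩ (fun s => s.F) k 1 (fun _ => r.curvature) ![f] *
          latticeSchwinger r.ρ ⟨sch.a, sch.a_pos, sch.tendsto_a, sch.β, sch.L, sch.tendsto_L, sch.c, m'⟩ (fun s => s.F) k 2 (fun _ => r.curvature)
            ![g, h] -
        latticeSchwinger r.ρ ⟨sch.a, sch.a_pos, sch.tendsto_a, sch.β, sch.L, sch.tendsto_L, sch.c, m'⟩ (fun s => s.F) k 1 (fun _ => r.curvature) ![g] *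
          latticeSchwinger r.ρ ⟨sch.a, sch.a_pos, sch.tendsto_a, sch.β, sch.L, sch.tendsto_L, sch.c, m'⟩ (fun s => s.F) k 2 (fun _ => r.curvature)
            ![f, h] -
        latticeSchwinger r.ρ ⟨sch.a, sch.a_pos, sch.tendsto_a, sch.β, sch.L, sch.tendsto_L, sch.c, m'⟩ (fun s => s.F) k 1 (fun _ => r.curvature) ![h] *
          latticeSchwinger r.ρ ⟨sch.a, sch.a_pos, sch.tendsto_a, sch.β, sch.L, sch.tendsto_L, sch.c, m'⟩ (fun s => s.F) k 2 (fun _ => r.curvature)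
            ![f, g] +
        2 * (latticeSchwinger r.ρ ⟨sch.a, sch.a_pos, sch.tendsto_a, sch.β, sch.L, sch.tendsto_L, sch.c, m'⟩ (fun s => s.F) k 1 (fun _ => r.curvature) ![f] *
          latticeSchwinger r.ρ ⟨sch.a, sch.a_pos, sch.tendsto_a, sch.β, sch.L, sch.tendsto_L, sch.c, m'⟩ (fun s => s.F) k 1 (fun _ => r.curvature) ![g] *
          latticeSchwinger r.ρ ⟨sch.a, sch.a_pos, sch.tendsto_a, sch.β, sch.L, sch.tendsto_L, sch.c, m'⟩ (fun s => s.F) k 1 (fun _ => r.curvature) ![h]) =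
      latticeSchwinger r.ρ sch (fun s => s.F) k 3 (fun _ => r.curvature) ![f, g, h] -
        latticeSchwinger r.ρ sch (fun s => s.F) k 1 (fun _ => r.curvature) ![f] *
          latticeSchwinger r.ρ sch (fun s => s.F) k 2 (fun _ => r.curvature) ![g, h] -
        latticeSchwinger r.ρ sch (fun s => s.F) k 1 (fun _ => r.curvature) ![g] *
          latticeSchwinger r.ρ sch (fun s => s.F) k 2 (fun _ => r.curvature) ![f, h] -
        latticeSchwinger r.ρ sch (fun s => s.F) k 1 (fun _ => r.curvature) ![h] *
          latticeSchwinger r.ρ sch (fun s => s.F) k 2 (fun _ => r.curvature) ![f, g] +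
        2 * (latticeSchwinger r.ρ sch (fun s => s.F) k 1 (fun _ => r.curvature) ![f] *
          latticeSchwinger r.ρ sch (fun s => s.F) k 1 (fun _ => r.curvature) ![g] *
          latticeSchwinger r.ρ sch (fun s => s.F) k 1 (fun _ => r.curvature) ![h]) := by
  haveI := isProbabilityMeasure_wilsonMeasure (d := 4) (L := sch.side k) r.ρ r.continuous (sch.β k)
  obtain ⟨hfm, hfb⟩ := irRecentre_field sch k r.curvature (sch.m r.curvature k) f
  obtain ⟨hgm, hgb⟩ := irRecentre_field sch k r.curvature (sch.m r.curvature k) g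
  obtain ⟨hhm, hhb⟩ := irRecentre_field sch k r.curvature (sch.m r.curvature k) h
  rw [irRecentre_S3' r sch m' k, irRecentre_S1' r sch m' k, irRecentre_S1' r sch m' k,
    irRecentre_S1' r sch m' k, irRecentre_S2' r sch m' k, irRecentre_S2' r sch m' k,
    irRecentre_S2' r sch m' k, irRecentre_S3 r sch k, irRecentre_S1 r sch k, irRecentre_S1 r sch k,
    irRecentre_S1 r sch k, irRecentre_S2 r sch k, irRecentre_S2 r sch k, irRecentre_S2 r sch k]
  exact irRecentre_cumulant_three hfm hfb hgm hgb hhm hhb _ _ _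

/-- `stub_irInputsRecentre` (W2, r11; M) — **`IRInputs` is blind to the counterterms.**  Clauses
(a) `HasLatticeMassGap` and (b) (RP-spectral clustering of slab functionals) read only `β, a, L`;
in (c), (d) each smeared curvature field of the re-centred scheme is that of `sch` plus the constant
`c_k a_k⁴ (Σ_{x∈box} f(a_k x))(m_k − m'_k)`, and the second and third cumulants of bounded random
variables under a probability measure are invariant under constant shifts (`latticeSchwinger`
unfolded with `Fin.prod_univ_two/three`; Wilson's torus measure is a probability measure).
[folklore] -/
theorem stub_irInputsRecentre :
    ∀ (G : Type) [Group G] [TopologicalSpace G] [IsTopologicalGroup G] [CompactSpace G]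
      [MeasurableSpace G] [BorelSpace G] (r : LatticeRep G) (sch : SpeciesScheme (YMSpecies G))
      (m' : YMSpecies G → ℕ → ℝ), IRInputs r sch →
      IRInputs r ⟨sch.a, sch.a_pos, sch.tendsto_a, sch.β, sch.L, sch.tendsto_L, sch.c, m'⟩ := by
  intro G _ _ _ _ _ _ r sch m' hI
  obtain ⟨h1, ⟨u, v, δ, hu, hv, hδ, h2⟩, ⟨f, g, h, δ', hfg, hfh, hgh, hδ', h3⟩⟩ := hI
  refine ⟨h1, ⟨u, v, δ, hu, hv, hδ, h2.mono fun k hk => ?_⟩,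
    ⟨f, g, h, δ', hfg, hfh, hgh, hδ', h3.mono fun k hk => ?_⟩⟩
  · rwa [irRecentre_two r sch m' k u v]
  · rwa [irRecentre_three r sch m' k f g h]

end App

end Summit.QuantumFields.YangMills.Theorems.WeakCouplingHypercubicLimit.TraceNormColdPressure

end
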